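import Summits.BirchSwinnertonDyer.Rank1Residual.F1Sign2.ParitySymbolCocycleAtTwoProofsGluedPair
import HarnessLib

/-!
# DESC-§22-HK (module D) — Cassels' halving lemma over an ARBITRARY field of characteristic 0 (hence at every completion: `ℚ₂`, `ℝ`, `ℚ_p`)

Field-generic port of part A (`KummerHalvingCriterion`, `K = ℚ`): for a field `K` with `CharZero K`, a Weierstrass curve
`W : y² = x³ + a₂x² + a₄x + a₆` over `K`, the cubic `c_W(T) = T³ + b₂T² + 8b₄T + 16b₆ ∈ K[T]`, `L_K = K[T]/(c_W)`, `θ` the class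
of `T`, and `P = (x_P, y_P) ∈ W(K)`:  `P ∈ 2W(K) ⟺ 4x_P − θ ∈ L_K^{2}`.  Instances recorded: `K = ℚ_[2]` (the LOCAL KUMMER
CRITERION AT 2: the local condition at 2 on a Selmer class is membership in `κ₂(W(ℚ₂))`, and this row identifies
`ker κ₂ = 2W(ℚ₂)`), `K = ℝ`, and `K = ℚ` (where `cubicK = twoDivisionUCubic` definitionally) — the instances live in the sequel
`F1Sign2/KummerFieldLocal.lean` (module E).

TYPER FILING (cell `bsd-f1-sign2`, seat `-ty` g9; CANDIDATES.md rows DESC-§22-HK (generic) / HK₂ / HK∞ / HK₂″ / B2; -desc g14 ADDENDUM 8/9,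
2026-08-28T10:44:20Z/10:49:59Z): the planner's `HOME/MEMO-desc-data/g14/lean/KummerFieldD.lean` e1a219a2855511e1 (299 l.; rc 0 standalone; evidence
`KummerField-concat.lean` rc 0 · 0 warnings · 0 sorries, standard axioms) VERBATIM from `noncomputable section` to `end`, landed under the planner's
suggested tree name; typer edits = this paragraph, the REF1/REF2 sentences, a `[cite: …]` tag on `KummerHalvingCriterionOver` and one-line docstrings
on nine helper lemmas (tree lint); statements and proofs byte-identical.  Builder `tools/mk_kfield.py D`, published under `HOME/MEMO-ty-data/g9/`.
REF1-AUDIT §94 (g9, 2026-08-28T10:59:52Z): B2 `LocalImageOneBitAtTwo` / B2K SURVIVE as typed, OPEN-in-tree / in print, CLEARED to file (ProbeB2 41730fdb696be1fa rc 0, axioms trio); modules D/E CLEARED statement+proof-only; hypotheses audit: `Irreducible (cubicK W)` load-bearing in B2 (eB2: the cusp `y² = x³` over `ℚ₂` is fully 2-divisible — the binders carry no `IsElliptic`, irreducibility does that job).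
REF2-PLACEMENT v25 §7 (0fe067e0b1982f3b, 2026-08-28T10:54:27Z): HK₂/HK₂″ KNOWN (Cassels 1991 §15 Lemmas 1–2 are field-generic; Silverman AEC X.1.1/X.1.4); B2 KNOWN IN PRINT / open in tree = Stoll 2001 Lemma 4.4 (1) «K a p-adic local field, d_K = [K:ℚ₂] if p = 2: dim J(K)/2J(K) = dim J(K)[2] + d_K·g» (proof → Schaefer 1998 Prop. 2.4 / Milne ADT Lemma I.3.3), at g = 1, K = ℚ₂; formalisation target (formal-group filtration of `E(ℚ₂)`); beyond-print theorem: no; PARTITION: none.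
Sources: Cassels, LMSST 24 (1991) §15 Lemma 2 [corpus:book:cassels1991-lmsst-lectures-elliptic-curves p.42–43] (field-generic as printed: «k any
field of characteristic ≠ 2»); the `K = ℚ` case is the tree's `F1Sign2/KummerHalvingCriterion.lean` (p625024, row H′).  BSD is not proved by any of this.
-/

noncomputable section

open scoped Classical

open WeierstrassCurve Polynomial

namespace Summit.BirchSwinnertonDyer.Rank1Residual.F1Sign2.KummerField

variable {K : Type*} [Field K]

/-- The `u`-cubic `c_W(T) = T³ + b₂T² + 8b₄T + 16b₆` over any field. -/
def cubicK (W : WeierstrassCurve K) : K[X] := X ^ 3 + C W.b₂ * X ^ 2 + C (8 * W.b₄) * X + C (16 * W.b₆)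

/-- `c_W` is monic. -/
lemma cubicK_monic (W : WeierstrassCurve K) : (cubicK W).Monic := by
  unfold cubicK; monicity!

/-- `c_W` has degree `3`. -/
lemma cubicK_natDegree (W : WeierstrassCurve K) : (cubicK W).natDegree = 3 := by
  unfold cubicK; compute_degree!

/-- The cubic algebra `L_K = K[T]/(c_W)` and the class `θ` of `T`. -/
abbrev algK (W : WeierstrassCurve K) : Type _ := AdjoinRoot (cubicK W)

/-- The class of `T`. -/
abbrev rootK (W : WeierstrassCurve K) : algK W := AdjoinRoot.root (cubicK W)

/-- `θ³ + b₂θ² + 8b₄θ + 16b₆ = 0` in `L_K`. -/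
lemma root_relation (W : WeierstrassCurve K) :
    rootK W ^ 3 + algebraMap K (algK W) W.b₂ * rootK W ^ 2 + algebraMap K (algK W) (8 * W.b₄) * rootK W +
      algebraMap K (algK W) (16 * W.b₆) = 0 := by
  have h : aeval (rootK W) (cubicK W) = 0 := by
    rw [AdjoinRoot.aeval_eq, AdjoinRoot.mk_self]
  simp only [cubicK, map_add, map_mul, map_pow, aeval_X, aeval_C] at h
  simpa [AdjoinRoot.algebraMap_eq] using h

/-! ## Coordinates in the cubic algebra (general `W`) -/

/-- Uniqueness of coordinates w.r.t. `1, θ, θ²` in `L = K[X]/(c_W)`. -/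
lemma coords_eq_zero (W : WeierstrassCurve K) (r₀ r₁ r₂ : K)
    (h : algebraMap K (algK W) r₀ + algebraMap K (algK W) r₁ * rootK W + algebraMap K (algK W) r₂ * rootK W ^ 2 = 0) :
    r₀ = 0 ∧ r₁ = 0 ∧ r₂ = 0 := by
  have hmk : AdjoinRoot.mk (cubicK W) (C r₂ * X ^ 2 + C r₁ * X + C r₀) = 0 := by
    rw [← AdjoinRoot.aeval_eq]
    simp only [map_add, map_mul, map_pow, aeval_C, aeval_X]
    linear_combination h
  rw [AdjoinRoot.mk_eq_zero] at hmk
  have hP0 : (C r₂ * X ^ 2 + C r₁ * X + C r₀ : K[X]) = 0 := by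
    by_contra hne
    have h1 := Polynomial.natDegree_le_of_dvd hmk hne
    have h2 : (C r₂ * X ^ 2 + C r₁ * X + C r₀ : K[X]).natDegree ≤ 2 := Polynomial.natDegree_quadratic_le
    rw [cubicK_natDegree] at h1
    omega
  have e0 : r₀ = 0 := by simpa using congrArg (Polynomial.coeff · 0) hP0
  have e1 : r₁ = 0 := by simpa using congrArg (Polynomial.coeff · 1) hP0
  have e2 : r₂ = 0 := by simpa using congrArg (Polynomial.coeff · 2) hP0
  exact ⟨e0, e1, e2⟩

/-- Every element of `L` has coordinates `α₀ + α₁θ + α₂θ²`. -/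
lemma exists_coords (W : WeierstrassCurve K) (v : (algK W)) :
    ∃ α₀ α₁ α₂ : K, v = algebraMap K (algK W) α₀ + algebraMap K (algK W) α₁ * rootK W + algebraMap K (algK W) α₂ * rootK W ^ 2 := by
  obtain ⟨p, hp⟩ := AdjoinRoot.mk_surjective v
  have hmonic := cubicK_monic W
  have hpq : AdjoinRoot.mk (cubicK W) p = AdjoinRoot.mk (cubicK W) (p %ₘ cubicK W) := by
    rw [AdjoinRoot.mk_eq_mk, Polynomial.modByMonic_eq_sub_mul_div p (cubicK W)]
    exact ⟨p /ₘ cubicK W, by ring⟩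
  have hne1 : cubicK W ≠ 1 := by
    intro h1
    have := congrArg Polynomial.natDegree h1
    rw [cubicK_natDegree] at this
    simp at this
  have hdeg : (p %ₘ cubicK W).natDegree ≤ 2 := by
    have := Polynomial.natDegree_modByMonic_lt p hmonic hne1
    rw [cubicK_natDegree] at this
    omega
  obtain ⟨c₀, c₁, c₂, hqexp⟩ : ∃ c₀ c₁ c₂ : K, p %ₘ cubicK W = C c₀ + C c₁ * X + C c₂ * X ^ 2 := by
    refine ⟨(p %ₘ cubicK W).coeff 0, (p %ₘ cubicK W).coeff 1, (p %ₘ cubicK W).coeff 2, ?_⟩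
    ext n
    rcases n with _ | _ | _ | n
    · simp
    · simp
    · simp
    · rw [Polynomial.coeff_eq_zero_of_natDegree_lt (by omega)]
      simp
  refine ⟨c₀, c₁, c₂, ?_⟩
  rw [← hp, hpq, hqexp, ← AdjoinRoot.aeval_eq]
  simp only [map_add, map_mul, map_pow, aeval_C, aeval_X]

/-! ## Weierstrass data for `a₁ = a₃ = 0` -/

/-- The affine equation for `a₁ = a₃ = 0`: `y² = x³ + a₂x² + a₄x + a₆`. -/
lemma equation_of_a₁_a₃ (W : WeierstrassCurve K) (h1 : W.a₁ = 0) (h3 : W.a₃ = 0) {x y : K} (h : W.toAffine.Equation x y) :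
    y ^ 2 = x ^ 3 + W.a₂ * x ^ 2 + W.a₄ * x + W.a₆ := by
  rw [WeierstrassCurve.Affine.equation_iff] at h
  simp only [h1, h3, zero_mul, add_zero] at h ⊢
  linear_combination h

/-- Negation is `(x, y) ↦ (x, −y)` when `a₁ = a₃ = 0`. -/
lemma negY_of_a₁_a₃ (W : WeierstrassCurve K) (h1 : W.a₁ = 0) (h3 : W.a₃ = 0) (x y : K) : W.toAffine.negY x y = -y := by
  simp [WeierstrassCurve.Affine.negY, h1, h3]

/-- `b₂ = 4a₂` when `a₁ = 0`. -/
lemma b₂_of_a₁ (W : WeierstrassCurve K) (h1 : W.a₁ = 0) : W.b₂ = 4 * W.a₂ := by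
  simp [WeierstrassCurve.b₂, h1]

/-- `b₄ = 2a₄` when `a₁ = a₃ = 0`. -/
lemma b₄_of_a₁_a₃ (W : WeierstrassCurve K) (h1 : W.a₁ = 0) (h3 : W.a₃ = 0) : W.b₄ = 2 * W.a₄ := by
  simp [WeierstrassCurve.b₄, h1, h3]

/-- `b₆ = 4a₆` when `a₃ = 0`. -/
lemma b₆_of_a₃ (W : WeierstrassCurve K) (h3 : W.a₃ = 0) : W.b₆ = 4 * W.a₆ := by
  simp [WeierstrassCurve.b₆, h3]

/-- The cubic relation `θ³ + 4a₂θ² + 16a₄θ + 64a₆ = 0` in `L`. -/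
lemma root_relation_of_a₁_a₃ (W : WeierstrassCurve K) (h1 : W.a₁ = 0) (h3 : W.a₃ = 0) :
    rootK W ^ 3 + 4 * algebraMap K (algK W) W.a₂ * rootK W ^ 2 +
      16 * algebraMap K (algK W) W.a₄ * rootK W + 64 * algebraMap K (algK W) W.a₆ = 0 := by
  have hF := root_relation W
  rw [b₂_of_a₁ W h1, b₄_of_a₁_a₃ W h1 h3, b₆_of_a₃ W h3] at hF
  simp only [map_mul, map_ofNat] at hF
  linear_combination hF

/-! ## Cassels' lemma -/

variable [CharZero K]

/-- Halving direction: `Q + Q = P ⇒ 4x_P − θ ∈ L^{2}`. -/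
theorem isSquare_of_halves (W : WeierstrassCurve K) (h1 : W.a₁ = 0) (h3 : W.a₃ = 0) {xP yP : K} (hP : W.toAffine.Nonsingular xP yP)
    (Q : W.toAffine.Point) (hQ : Q + Q = WeierstrassCurve.Affine.Point.some xP yP hP) :
    IsSquare (algebraMap K (algK W) (4 * xP) - rootK W) := by
  rcases Q with _ | ⟨x₀, y₀, hQ0⟩
  · simp only [← WeierstrassCurve.Affine.Point.zero_def, add_zero] at hQ
    exact absurd hQ.symm (WeierstrassCurve.Affine.Point.some_ne_zero _)
  · by_cases hy : y₀ = W.toAffine.negY x₀ y₀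
    · rw [WeierstrassCurve.Affine.Point.add_self_of_Y_eq hy] at hQ
      exact absurd hQ.symm (WeierstrassCurve.Affine.Point.some_ne_zero _)
    · rw [WeierstrassCurve.Affine.Point.add_self_of_Y_ne hy] at hQ
      have hx : W.toAffine.addX x₀ x₀ (W.toAffine.slope x₀ x₀ y₀ y₀) = xP :=
        (WeierstrassCurve.Affine.Point.some.injEq _ _ _ _ _ _).mp hQ |>.1
      rw [WeierstrassCurve.Affine.slope_of_Y_ne rfl hy] at hx
      have hy0 : y₀ ≠ 0 := by
        intro h0; apply hy; rw [negY_of_a₁_a₃ W h1 h3, h0, neg_zero]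
      have heq := equation_of_a₁_a₃ W h1 h3 hQ0.1
      simp only [negY_of_a₁_a₃ W h1 h3, WeierstrassCurve.Affine.addX, h1] at hx
      have h2y : (y₀ - -y₀) ≠ 0 := by
        intro h0; apply hy0; exact (mul_eq_zero.mp (show (2 : K) * y₀ = 0 by linear_combination h0)).resolve_left two_ne_zero
      have hx1 : (3 * x₀ ^ 2 + 2 * W.a₂ * x₀ + W.a₄) ^ 2 = 4 * y₀ ^ 2 * (xP + W.a₂ + 2 * x₀) := by
        field_simp at hx
        linear_combination hx
      have hF := root_relation_of_a₁_a₃ W h1 h3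
      have h16y : (16 * y₀) ≠ 0 := mul_ne_zero (by norm_num) hy0
      have hW0 := congrArg (algebraMap K (algK W)) (mul_inv_cancel₀ h16y)
      have heq' := congrArg (algebraMap K (algK W)) heq
      have hx1' := congrArg (algebraMap K (algK W)) hx1
      simp only [map_mul, map_ofNat, map_pow, map_add, map_one] at hW0 heq' hx1'
      refine ⟨algebraMap K (algK W) ((16 * y₀)⁻¹) *
        ((algebraMap K (algK W) (4 * x₀) - rootK W) ^ 2 -
          (3 * rootK W ^ 2 + algebraMap K (algK W) (8 * W.a₂) * rootK W + algebraMap K (algK W) (16 * W.a₄))), ?_⟩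
      simp only [map_mul, map_ofNat]
      generalize rootK W = t at hF ⊢
      generalize algebraMap K (algK W) ((16 * y₀)⁻¹) = Wc at hW0 ⊢
      generalize algebraMap K (algK W) x₀ = X at heq' hx1' ⊢
      generalize algebraMap K (algK W) xP = XP at hx1' ⊢
      generalize algebraMap K (algK W) y₀ = Y at heq' hx1' hW0 ⊢
      generalize algebraMap K (algK W) W.a₂ = B at hF heq' hx1' ⊢
      generalize algebraMap K (algK W) W.a₄ = A4 at hF heq' hx1' ⊢
      generalize algebraMap K (algK W) W.a₆ = A6 at hF heq' ⊢
      linear_combination (-(256 * Wc ^ 2)) * hx1' + (-(256 * Wc ^ 2 * (4 * B + 8 * X + t))) * heq' +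
        (-(4 * Wc ^ 2 * (t + 8 * X + 4 * B))) * hF + (-((4 * XP - t) * (16 * Y * Wc + 1))) * hW0

/-- **CASSELS' LEMMA** (constructive): `4x_P − θ ∈ L^{2} ⇒ P ∈ 2E(K)`, half `Q = (α₁/(4α₂) − a₂, −1/(8α₂))`. -/
theorem exists_halves_of_isSquare (W : WeierstrassCurve K) (h1 : W.a₁ = 0) (h3 : W.a₃ = 0) {xP yP : K} (hP : W.toAffine.Nonsingular xP yP)
    (hsq : IsSquare (algebraMap K (algK W) (4 * xP) - rootK W)) :
    ∃ Q : W.toAffine.Point, Q + Q = WeierstrassCurve.Affine.Point.some xP yP hP := by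
  obtain ⟨v, hv⟩ := hsq
  obtain ⟨α₀, α₁, α₂, hvexp⟩ := exists_coords W v
  have hF := root_relation_of_a₁_a₃ W h1 h3
  have hPeq := equation_of_a₁_a₃ W h1 h3 hP.1
  -- (1) α₂ ≠ 0
  have hα₂ : α₂ ≠ 0 := by
    intro h0
    have hA2 : algebraMap K (algK W) α₂ = 0 := by rw [h0, map_zero]
    have key : algebraMap K (algK W) (α₀ ^ 2 - 4 * xP) + algebraMap K (algK W) (2 * α₀ * α₁ + 1) * rootK W +
        algebraMap K (algK W) (α₁ ^ 2) * rootK W ^ 2 = 0 := by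
      simp only [map_add, map_sub, map_mul, map_pow, map_one, map_ofNat] at hv ⊢
      generalize rootK W = t at hv hvexp ⊢
      generalize algebraMap K (algK W) α₀ = A0 at hvexp ⊢
      generalize algebraMap K (algK W) α₁ = A1 at hvexp ⊢
      generalize algebraMap K (algK W) α₂ = A2 at hvexp hA2 ⊢
      generalize algebraMap K (algK W) xP = XP at hv ⊢
      linear_combination (-1 : (algK W)) * hv + (-(v + (A0 + A1 * t + A2 * t ^ 2))) * hvexp +
        (-(t ^ 2 * (2 * A0 + 2 * A1 * t + A2 * t ^ 2))) * hA2
    obtain ⟨-, h1', h2'⟩ := coords_eq_zero W _ _ _ key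
    have : α₁ = 0 := pow_eq_zero_iff (two_ne_zero) |>.mp h2'
    rw [this] at h1'
    norm_num at h1'
  -- (2) the half `Q = (x₀, y₀)` and the defect `r`
  obtain ⟨y₀, hy⟩ : ∃ y₀ : K, 8 * α₂ * y₀ = -1 :=
    ⟨-(8 * α₂)⁻¹, by rw [mul_neg, mul_inv_cancel₀ (mul_ne_zero (by norm_num) hα₂)]⟩
  have hy0 : y₀ ≠ 0 := by rintro rfl; norm_num at hy
  obtain ⟨x₀, hx⟩ : ∃ x₀ : K, 4 * α₂ * (x₀ + W.a₂) = α₁ :=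
    ⟨α₁ / (4 * α₂) - W.a₂, by rw [sub_add_cancel, mul_div_cancel₀ _ (mul_ne_zero (by norm_num) hα₂)]⟩
  obtain ⟨r, hr⟩ : ∃ r : K, r * y₀ = x₀ ^ 2 - W.a₄ - α₀ * y₀ :=
    ⟨(x₀ ^ 2 - W.a₄ - α₀ * y₀) / y₀, div_mul_cancel₀ _ hy0⟩
  have hy' := congrArg (algebraMap K (algK W)) hy
  have hx' := congrArg (algebraMap K (algK W)) hx
  have hr' := congrArg (algebraMap K (algK W)) hr
  simp only [map_mul, map_ofNat, map_neg, map_one, map_add, map_sub, map_pow] at hy' hx' hr'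
  -- (3) the coefficient equation in L
  have hK : algebraMap K (algK W) (256 * y₀ ^ 2 * r ^ 2 + 512 * y₀ ^ 2 * r * α₀ + 1024 * y₀ ^ 2 * xP -
        256 * (3 * x₀ ^ 2 + 2 * W.a₂ * x₀ + W.a₄) ^ 2 + 256 * (x₀ ^ 3 + W.a₂ * x₀ ^ 2 + W.a₄ * x₀ + W.a₆) * (4 * W.a₂ + 8 * x₀)) +
      algebraMap K (algK W) (-256 * y₀ ^ 2 + 512 * y₀ ^ 2 * r * α₁ + 256 * (x₀ ^ 3 + W.a₂ * x₀ ^ 2 + W.a₄ * x₀ + W.a₆)) *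
        rootK W +
      algebraMap K (algK W) (512 * y₀ ^ 2 * r * α₂) * rootK W ^ 2 = 0 := by
    simp only [map_mul, map_ofNat, map_neg, map_add, map_sub, map_pow] at hv ⊢
    generalize rootK W = t at hF hv hvexp ⊢
    generalize algebraMap K (algK W) x₀ = X0 at hx' hr' ⊢
    generalize algebraMap K (algK W) xP = XP at hv ⊢
    generalize algebraMap K (algK W) y₀ = Y0 at hy' hr' ⊢
    generalize algebraMap K (algK W) r = Rr at hr' ⊢
    generalize algebraMap K (algK W) α₀ = A0 at hvexp hr' ⊢
    generalize algebraMap K (algK W) α₁ = A1 at hvexp hx' ⊢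
    generalize algebraMap K (algK W) α₂ = A2 at hvexp hy' hx' ⊢
    generalize algebraMap K (algK W) W.a₂ = B at hF hx' ⊢
    generalize algebraMap K (algK W) W.a₄ = A4 at hF hr' ⊢
    generalize algebraMap K (algK W) W.a₆ = A6 at hF ⊢
    have hMi : (4 * X0 - t) ^ 2 - (3 * t ^ 2 + 8 * B * t + 16 * A4) = 16 * Y0 * (v + Rr) := by
      linear_combination (-(16 * Y0)) * hvexp + (-(2 * t ^ 2) - 8 * (X0 + B) * t) * hy' + (16 * Y0 * t) * hx' +
        (-16 : (algK W)) * hr'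
    linear_combination (256 * Y0 ^ 2) * hv + (-(512 * Y0 ^ 2 * Rr)) * hvexp +
      (-(16 * Y0 * (v + Rr) + ((4 * X0 - t) ^ 2 - (3 * t ^ 2 + 8 * B * t + 16 * A4)))) * hMi +
      (4 * (t + 8 * X0 + 4 * B)) * hF
  obtain ⟨hk0, hk1, hk2⟩ := coords_eq_zero W _ _ _ hK
  -- (4) read off: r = 0, the curve equation, x(2Q) = x_P
  have hr0 : r = 0 := by
    by_contra hne
    exact (mul_ne_zero (mul_ne_zero (mul_ne_zero (by norm_num) (pow_ne_zero 2 hy0)) hne) hα₂) hk2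
  rw [hr0] at hk0 hk1
  have heq : y₀ ^ 2 = x₀ ^ 3 + W.a₂ * x₀ ^ 2 + W.a₄ * x₀ + W.a₆ := by
    linear_combination (-1 / 256 : K) * hk1
  have hdup : (3 * x₀ ^ 2 + 2 * W.a₂ * x₀ + W.a₄) ^ 2 = 4 * y₀ ^ 2 * (xP + W.a₂ + 2 * x₀) := by
    linear_combination (-1 / 256 : K) * hk0 + (-(4 * W.a₂ + 8 * x₀)) * heq
  -- (5) the point Q = (x₀, y₀)
  have hQns : W.toAffine.Nonsingular x₀ y₀ := by
    rw [WeierstrassCurve.Affine.nonsingular_iff']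
    refine ⟨?_, Or.inr ?_⟩
    · rw [WeierstrassCurve.Affine.equation_iff']
      simp only [h1, h3, zero_mul, add_zero]
      linear_combination heq
    · simp only [h1, h3, zero_mul, add_zero]
      intro h0; apply hy0; exact (mul_eq_zero.mp (show (2 : K) * y₀ = 0 by linear_combination h0)).resolve_left two_ne_zero
  have hyne : y₀ ≠ W.toAffine.negY x₀ y₀ := by
    rw [negY_of_a₁_a₃ W h1 h3]; intro h0; apply hy0; exact (mul_eq_zero.mp (show (2 : K) * y₀ = 0 by linear_combination h0)).resolve_left two_ne_zero
  obtain ⟨X2, Y2, H2, hQQ, hX2⟩ : ∃ (X2 Y2 : K) (H2 : W.toAffine.Nonsingular X2 Y2),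
      WeierstrassCurve.Affine.Point.some x₀ y₀ hQns + WeierstrassCurve.Affine.Point.some x₀ y₀ hQns =
        WeierstrassCurve.Affine.Point.some X2 Y2 H2 ∧ X2 = xP := by
    refine ⟨_, _, _, WeierstrassCurve.Affine.Point.add_self_of_Y_ne hyne, ?_⟩
    rw [WeierstrassCurve.Affine.slope_of_Y_ne rfl hyne]
    simp only [negY_of_a₁_a₃ W h1 h3, WeierstrassCurve.Affine.addX, h1]
    have h2y : (y₀ - -y₀) ≠ 0 := by intro h0; apply hy0; exact (mul_eq_zero.mp (show (2 : K) * y₀ = 0 by linear_combination h0)).resolve_left two_ne_zero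
    field_simp
    linear_combination hdup
  have hY2 : Y2 ^ 2 = yP ^ 2 := by
    have := equation_of_a₁_a₃ W h1 h3 H2.1
    rw [hX2] at this
    linear_combination this - hPeq
  have key : ∀ {x y : K} {hxy : W.toAffine.Nonsingular x y}, x = xP → y = yP →
      WeierstrassCurve.Affine.Point.some x y hxy = WeierstrassCurve.Affine.Point.some xP yP hP := by
    rintro x y hxy rfl rfl; rfl
  rcases sq_eq_sq_iff_eq_or_eq_neg.mp hY2 with hc1 | hc2
  · exact ⟨WeierstrassCurve.Affine.Point.some x₀ y₀ hQns, hQQ.trans (key hX2 hc1)⟩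
  · refine ⟨-WeierstrassCurve.Affine.Point.some x₀ y₀ hQns, ?_⟩
    rw [← neg_add, hQQ, WeierstrassCurve.Affine.Point.neg_some]
    apply key hX2
    rw [negY_of_a₁_a₃ W h1 h3, hc2, neg_neg]

/-- **Cassels' lemma, both directions**, for every `W/ℚ` with `a₁ = a₃ = 0`. -/
theorem halves_iff_isSquare (W : WeierstrassCurve K) (h1 : W.a₁ = 0) (h3 : W.a₃ = 0) {xP yP : K} (hP : W.toAffine.Nonsingular xP yP) :
    (∃ Q : W.toAffine.Point, Q + Q = WeierstrassCurve.Affine.Point.some xP yP hP) ↔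
      IsSquare (algebraMap K (algK W) (4 * xP) - rootK W) :=
  ⟨fun ⟨Q, hQ⟩ => isSquare_of_halves W h1 h3 hP Q hQ, exists_halves_of_isSquare W h1 h3 hP⟩

/-- DESC-§22-H′ (support, KNOWN in print as Cassels' lemma; uniform `AdjoinRoot` form): for every `W : y² = x³ + a₂x² + a₄x + a₆` over `ℚ` and every
`P = (x_P, y_P) ∈ W(K)`: `P ∈ 2W(K) ⟺ 4x_P − θ_W ∈ (K[T]/(c_W))^{2}`.
REF1 §94: CLEARED (statement+proof).  REF2 v25 §7: KNOWN — Cassels 1991 §15 Lemma 2 is field-generic («k any field of characteristic ≠ 2»);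
formalisation; beyond-print no.  [cite: Cassels1991, §15 Lemma 2] -/
def KummerHalvingCriterionOver (K : Type*) [Field K] [CharZero K] : Prop :=
  ∀ (W : WeierstrassCurve K), W.a₁ = 0 → W.a₃ = 0 → ∀ (xP yP : K) (hP : W.toAffine.Nonsingular xP yP),
    (∃ Q : W.toAffine.Point, Q + Q = WeierstrassCurve.Affine.Point.some xP yP hP) ↔
      IsSquare (algebraMap K (algK W) (4 * xP) - rootK W)

/-- Row DESC-§22-HK holds over every field of characteristic `0` (`halves_iff_isSquare`). -/
theorem kummerHalvingCriterionOver_holds : KummerHalvingCriterionOver K :=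
  fun W h1 h3 _ _ hP => halves_iff_isSquare W h1 h3 hP

end Summit.BirchSwinnertonDyer.Rank1Residual.F1Sign2.KummerField
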